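import Mathlib
import Summits.NavierStokesRegularity.NavierStokesRegularity.Theorems.FilamentSkeletonRssSkeletonJ1RLiaDefectDerivPartnerBound
import Summits.NavierStokesRegularity.NavierStokesRegularity.Theorems.FilamentSkeletonRssSkeletonJ1RLiaDefectDerivSplitBounds

/-!
# Crux `SkeletonJ1R` (stmt-NavierStokesRegularity-23610) · line `streamline_kantorovich_R` · stub F2-d (`LiaDefectDerivBL`, v7):
# THE PARTNER HALF B2′ IS PROVED — `LiaDefectDerivBL` now follows from the self-strand derivative bound B1′ ALONE

Hand `leafhand-ns-filamentskeletonrs-1` (gen 0), `--supports stmt-NavierStokesRegularity-23610 --as helper`.  MODEL rung, NEGATIVE side of the ladder: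
estimates for a HYPOTHETICAL filament-type blow-up skeleton; nothing here is a claim about Navier–Stokes regularity; the stub and the crux stay OPEN.

* `IsLiaReference.lorentzDeriv_eq_integral_derivKernel` — the closed-form derivative of a partner's datum-line strand along the reference (the Lorentzian
  derivative `Ḃ_k` of `…LiaDefectDerivStrands.hasDerivAt_datumStrand_comp`) IS the derivative-kernel strand integral of the datum line
  `∫ G(x_jτ − L_kσ, t_k, x_j′τ) dσ` (uniqueness of derivatives against `hasDerivAt_strand_comp` for the `C^∞` unit-speed datum line).
* `liaDefectDeriv_partner_bound` — hypothesis `hpart` (B2′) of `…LiaDefectDerivSplitBounds.liaDefectDerivBL_of_self_and_partner_deriv_bounds`, with the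
  quantifier prefix of `LiaDefectBL`: on the collar `ℓ² ≤ ‖x_jτ‖² < 2ℓ²`, `ℓ·Σ_{k≠j} ‖c_k (Ȧ_k − Ḃ_k)‖ ≤ Cp (√Γ+|τ|)/√log Γ` — assembly of
  `…LiaDefectDerivPartnerBound.partnerDerivTerm_bound` over the partners exactly as `…LiaDefectB.stub_liaDefectBL` assembles B2 (general position
  `θg = min θd 1`, tilt budget `tiltBudget_exists`, `|τ| ≤ 3ℓ` on the closed switched region by `abs_param_le_of_sq_le_two`).
* `liaDefectDerivBL_of_self_deriv_bound` — the registered stub `LiaDefectDerivBL` from the single remaining estimate B1′ (self strand: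
  `ℓ·‖P⊥(c_j Ȧ_j − β·(x_j′ × (β⁻¹(x_j″ × W + x_j′ × DW·x_j′)) + x_j″ × x_j″))‖ ≤ C (√Γ+|τ|)/√log Γ` at interior collar points).
WHAT REMAINS for F2-d: B1′ only (the window/envelope split S2–S4 of the F2-B self chain redone with the derivative kernels; `|s| ≳ ℓ` pays the extra `1/|s|`).
-/

set_option linter.dupNamespace false -- `NavierStokesRegularity.NavierStokesRegularity` path/namespace repetition is the tree convention

noncomputable section

namespace Summit.NavierStokesRegularity.NavierStokesRegularity.Theorems.SkeletonJ1RFrame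

open Set Function Filter Real Topology MeasureTheory
open Literature.Analysis.FluidPDE
open Summit.NavierStokesRegularity.NavierStokesRegularity.Theorems.FilamentSkeletonRssSkeletonJ1GSplit (NearStraightJ1G StraightDatum)
open scoped InnerProductSpace BigOperators

/-! ## §1 The Lorentzian derivative is the derivative-kernel strand of the datum line -/

/-- **`Ḃ_k` in closed form = the derivative-kernel strand integral of the datum line** along a unit-speed `C²` reference. [folklore] -/
theorem IsLiaReference.lorentzDeriv_eq_integral_derivKernel {N : ℕ} {Γ Rb : ℝ} {p t : Fin N → EuclideanSpace ℝ (Fin 3)} {γ : Fin N → ℝ}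
    {α : ℝ} {s₀ : Fin N → ℝ} {x : Fin N → ℝ → EuclideanSpace ℝ (Fin 3)} (hx : IsLiaReference Γ Rb p t γ α s₀ x) (ht : ∀ k, ‖t k‖ = 1)
    (j k : Fin N) (τ : ℝ) :
    (-(2 * (2 * ⟪x j τ - waistPt Γ p t s₀ k, deriv (x j) τ⟫_ℝ -
          2 * ⟪x j τ - waistPt Γ p t s₀ k, t k⟫_ℝ * ⟪deriv (x j) τ, t k⟫_ℝ)) /
        (‖x j τ - waistPt Γ p t s₀ k‖ ^ 2 - ⟪x j τ - waistPt Γ p t s₀ k, t k⟫_ℝ ^ 2 +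
          Real.exp (-(1+Real.eulerMascheroniConstant-Real.log 2)) * (1:ℝ)) ^ 2) • cross (t k) (x j τ - waistPt Γ p t s₀ k) +
      (2 / (‖x j τ - waistPt Γ p t s₀ k‖ ^ 2 - ⟪x j τ - waistPt Γ p t s₀ k, t k⟫_ℝ ^ 2 +
        Real.exp (-(1+Real.eulerMascheroniConstant-Real.log 2)) * (1:ℝ))) • cross (t k) (deriv (x j) τ) =
      ∫ σ : ℝ, ((-3 * ⟪x j τ - datumLine Γ p t s₀ k σ, deriv (x j) τ⟫_ℝ *
          ((‖x j τ - datumLine Γ p t s₀ k σ‖ ^ 2 + Real.exp (-(1+Real.eulerMascheroniConstant-Real.log 2)) * (1:ℝ)) ^ (5 / 2 : ℝ))⁻¹) •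
        cross (t k) (x j τ - datumLine Γ p t s₀ k σ) +
      ((‖x j τ - datumLine Γ p t s₀ k σ‖ ^ 2 + Real.exp (-(1+Real.eulerMascheroniConstant-Real.log 2)) * (1:ℝ)) ^ (3 / 2 : ℝ))⁻¹ •
        cross (t k) (deriv (x j) τ)) := by
  have hy : HasDerivAt (x j) (deriv (x j) τ) τ := (((hx j).1.differentiable (by norm_num)) τ).hasDerivAt
  have h1 := hasDerivAt_datumStrand_comp Γ p t s₀ ht k hy
  have hL1 : ∀ σ, ‖deriv (datumLine Γ p t s₀ k) σ‖ ≤ 1 := fun σ => by rw [deriv_datumLine, ht k]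
  have h2 := hasDerivAt_strand_comp (X := datumLine Γ p t s₀ k) one_pos ((contDiff_datumLine Γ p t s₀ k).of_le le_top) hL1
    (norm_datumLine_ge Γ p t s₀ k (ht k)) hy
  simp only [deriv_datumLine] at h2
  exact h1.unique h2

/-! ## §2 B2′ with the quantifier prefix of `LiaDefectBL` (hypothesis `hpart` of the split lemma) -/

set_option maxHeartbeats 1600000 in
/-- **B2′ — the partner half of the remaining F2-d estimate** (hypothesis `hpart` of `liaDefectDerivBL_of_self_and_partner_deriv_bounds`). [folklore] -/
theorem liaDefectDeriv_partner_bound :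
    ∀ (N : ℕ) (δd ρd Λd Rwd θd mw : ℝ) (p t : Fin N → EuclideanSpace ℝ (Fin 3)) (γ : Fin N → ℝ) (α : ℝ) (s₀ : Fin N → ℝ),
      0 < N → 0 < δd → 0 < ρd → 0 < Rwd → 0 < θd → 0 < mw → StraightDatum N δd ρd Λd Rwd θd mw p t γ α s₀ →
      (∀ j k, j ≠ k → |⟪t j, t k⟫_ℝ| ≤ 1 - θd) →
      ∃ Rb₁ : ℝ, 0 < Rb₁ ∧ ∀ Rb : ℝ, 0 < Rb → Rb ≤ Rb₁ → ∃ (Γ₁ Cp : ℝ), ∀ Γ : ℝ, Γ₁ ≤ Γ →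
        ∀ (x : Fin N → ℝ → EuclideanSpace ℝ (Fin 3)) (M : EuclideanSpace ℝ (Fin 3) → EuclideanSpace ℝ (Fin 3)),
          IsLiaReference Γ Rb p t γ α s₀ x → SlicedFrame Γ ρd 1 Rb p t s₀ x M →
          ∀ j τ, (Rb * Real.sqrt (Γ * Real.log Γ)) ^ 2 ≤ ‖x j τ‖ ^ 2 → ‖x j τ‖ ^ 2 < 2 * (Rb * Real.sqrt (Γ * Real.log Γ)) ^ 2 →
            Rb * Real.sqrt (Γ * Real.log Γ) *
              ∑ k ∈ Finset.univ.erase j, ‖(Γ * γ k / (4 * Real.pi)) • ((∫ σ : ℝ, ((-3 * ⟪x j τ - x k σ, deriv (x j) τ⟫_ℝ *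
                    ((‖x j τ - x k σ‖ ^ 2 + Real.exp (-(1 + Real.eulerMascheroniConstant - Real.log 2)) * (1:ℝ)) ^ (5 / 2 : ℝ))⁻¹) •
                  cross (deriv (x k) σ) (x j τ - x k σ) +
                ((‖x j τ - x k σ‖ ^ 2 + Real.exp (-(1 + Real.eulerMascheroniConstant - Real.log 2)) * (1:ℝ)) ^ (3 / 2 : ℝ))⁻¹ •
                  cross (deriv (x k) σ) (deriv (x j) τ))) -
                ((-(2 * (2 * ⟪x j τ - waistPt Γ p t s₀ k, deriv (x j) τ⟫_ℝ -
                      2 * ⟪x j τ - waistPt Γ p t s₀ k, t k⟫_ℝ * ⟪deriv (x j) τ, t k⟫_ℝ)) /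
                    (‖x j τ - waistPt Γ p t s₀ k‖ ^ 2 - ⟪x j τ - waistPt Γ p t s₀ k, t k⟫_ℝ ^ 2 +
                      Real.exp (-(1+Real.eulerMascheroniConstant-Real.log 2)) * (1:ℝ)) ^ 2) • cross (t k) (x j τ - waistPt Γ p t s₀ k) +
                (2 / (‖x j τ - waistPt Γ p t s₀ k‖ ^ 2 - ⟪x j τ - waistPt Γ p t s₀ k, t k⟫_ℝ ^ 2 +
                    Real.exp (-(1+Real.eulerMascheroniConstant-Real.log 2)) * (1:ℝ))) • cross (t k) (deriv (x j) τ)))‖ ≤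
              Cp * (Real.sqrt Γ + |τ|) / Real.sqrt (Real.log Γ) := by
  intro N δd ρd Λd Rwd θd mw p t γ α s₀ hN hδ hρ hRw hθ hmw hSD hGP
  obtain ⟨ht, hsep, -, hparams, hq, -⟩ := hSD
  -- general position with θg = min θd 1 ∈ (0, 1]
  set θg := min θd 1 with hθg
  have hθg0 : 0 < θg := lt_min hθ one_pos
  have hθg1 : θg ≤ 1 := min_le_right _ _
  have hGP' : ∀ j k, j ≠ k → |inner ℝ (t j) (t k)| ≤ 1 - θg := fun j k hjk =>
    (hGP j k hjk).trans (by linarith [min_le_left θd 1])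
  -- parameter bounds from the datum
  have hγlo : ∀ k, θd ≤ |γ k| := fun k => (hparams.2.2 k).1
  have hγhi : ∀ k, |γ k| ≤ θd⁻¹ := fun k => (hparams.2.2 k).2
  have hα : |α| ≤ θd⁻¹ := hparams.2.1
  -- tilt budget
  obtain ⟨θ₁, hθ₁0, hθ₁h, hθ₁A⟩ := tiltBudget_exists θg ρd (fun j => p j + s₀ j • t j) hθg0 hρ
  -- the tolerance ceiling
  set cst : ℝ := min (ρd / 4) (3 * ρd * Real.sqrt θg / (16 * (2 * Rwd + ρd / 2))) with hcst
  have hcst0 : 0 < cst := by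
    have := Real.sqrt_pos.2 hθg0
    exact lt_min (by positivity) (by positivity)
  set Rb₁ : ℝ := min (4 * θ₁) (min (4 / 5) (4 * cst / (5 * (2 * Rwd + 1)))) with hRb₁
  have hRb₁0 : 0 < Rb₁ := lt_min (by positivity) (lt_min (by norm_num) (by positivity))
  refine ⟨Rb₁, hRb₁0, fun Rb hRb hRbR => ?_⟩
  have hRbθ : Rb / 8 ≤ θ₁ := by have : Rb ≤ 4 * θ₁ := hRbR.trans (min_le_left _ _); linarith
  have hRb45 : Rb ≤ 4 / 5 := hRbR.trans ((min_le_right _ _).trans (min_le_left _ _))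
  have hRbg : Rb ≤ 4 * cst / (5 * (2 * Rwd + 1)) := hRbR.trans ((min_le_right _ _).trans (min_le_right _ _))
  -- the Γ-bookkeeping brick B2′
  obtain ⟨Cpart, Lp, hCpart0, hpart⟩ := partnerDerivTerm_bound N hθ hθg0 hθg1 hρ hRw.le hRb hRb45 hRbg
  set Mx : ℝ := max Lp (max ((12 * Rwd / Rb) ^ 2) 1) with hMx
  refine ⟨Real.exp Mx, N * Cpart, fun Γ hΓ x M hx hSF j τ hlow hint => ?_⟩
  -- Γ-level facts
  have hΓe : Real.exp 1 ≤ Γ := (Real.exp_le_exp.2 ((le_max_right _ _).trans (le_max_right _ _))).trans hΓ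
  have hΓ1 : 1 < Γ := lt_of_lt_of_le (by have := Real.add_one_lt_exp (one_ne_zero (α := ℝ)); linarith) hΓe
  have hΓ0 : 0 < Γ := by linarith
  have hlog : Mx ≤ Real.log Γ := (Real.le_log_iff_exp_le hΓ0).2 hΓ
  have hLp : Lp ≤ Real.log Γ := (le_max_left _ _).trans hlog
  have hsL : 12 * Rwd / Rb ≤ Real.sqrt (Real.log Γ) := by
    have h : (12 * Rwd / Rb) ^ 2 ≤ Real.log Γ := ((le_max_left _ _).trans (le_max_right _ _)).trans hlog
    have := Real.sqrt_le_sqrt h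
    rwa [Real.sqrt_sq (by positivity)] at this
  obtain ⟨hSR, -⟩ := hSF
  obtain ⟨-, htilt, -, -⟩ := hSR
  have hRHS0 : 0 ≤ Cpart * (Real.sqrt Γ + |τ|) / Real.sqrt (Real.log Γ) := by positivity
  -- on the collar |τ| ≤ 3ℓ, and the tangent is a unit direction
  have hτ : |τ| ≤ 3 * Rb * Real.sqrt Γ * Real.sqrt (Real.log Γ) :=
    abs_param_le_of_sq_le_two hx hΓ1 hRb hRb45 j (htilt j) (hq j) hsL hint.le
  have hP1 : ‖deriv (x j) τ‖ ≤ 1 := ((hx j).2.1 τ).le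
  -- each partner term, with the Lorentzian derivative rewritten as the datum-line derivative strand
  have h2 : ∀ k ∈ Finset.univ.erase j,
      Rb * Real.sqrt (Γ * Real.log Γ) * ‖(Γ * γ k / (4 * Real.pi)) • ((∫ σ : ℝ, ((-3 * ⟪x j τ - x k σ, deriv (x j) τ⟫_ℝ *
            ((‖x j τ - x k σ‖ ^ 2 + Real.exp (-(1 + Real.eulerMascheroniConstant - Real.log 2)) * (1:ℝ)) ^ (5 / 2 : ℝ))⁻¹) •
          cross (deriv (x k) σ) (x j τ - x k σ) +
        ((‖x j τ - x k σ‖ ^ 2 + Real.exp (-(1 + Real.eulerMascheroniConstant - Real.log 2)) * (1:ℝ)) ^ (3 / 2 : ℝ))⁻¹ •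
          cross (deriv (x k) σ) (deriv (x j) τ))) -
        ((-(2 * (2 * ⟪x j τ - waistPt Γ p t s₀ k, deriv (x j) τ⟫_ℝ -
              2 * ⟪x j τ - waistPt Γ p t s₀ k, t k⟫_ℝ * ⟪deriv (x j) τ, t k⟫_ℝ)) /
            (‖x j τ - waistPt Γ p t s₀ k‖ ^ 2 - ⟪x j τ - waistPt Γ p t s₀ k, t k⟫_ℝ ^ 2 +
              Real.exp (-(1+Real.eulerMascheroniConstant-Real.log 2)) * (1:ℝ)) ^ 2) • cross (t k) (x j τ - waistPt Γ p t s₀ k) +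
        (2 / (‖x j τ - waistPt Γ p t s₀ k‖ ^ 2 - ⟪x j τ - waistPt Γ p t s₀ k, t k⟫_ℝ ^ 2 +
            Real.exp (-(1+Real.eulerMascheroniConstant-Real.log 2)) * (1:ℝ))) • cross (t k) (deriv (x j) τ)))‖ ≤
      Cpart * (Real.sqrt Γ + |τ|) / Real.sqrt (Real.log Γ) := fun k hk => by
    rw [hx.lorentzDeriv_eq_integral_derivKernel ht j k τ]
    exact hpart hΓ1 hLp hx ht hGP' hsep hθ₁0.le (fun j k _ => hθ₁A j k) htilt hRbθ hγlo hγhi hα hq j k (Finset.ne_of_mem_erase hk) hτ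
      (deriv (x j) τ) hP1 hlow
  rw [Finset.mul_sum]
  have hsum := Finset.sum_le_sum h2
  rw [Finset.sum_const, nsmul_eq_mul] at hsum
  have hcard : ((Finset.univ.erase j).card : ℝ) ≤ N := by
    rw [Finset.card_erase_of_mem (Finset.mem_univ j), Finset.card_univ, Fintype.card_fin]; exact_mod_cast Nat.sub_le N 1
  calc _ ≤ ((Finset.univ.erase j).card : ℝ) * (Cpart * (Real.sqrt Γ + |τ|) / Real.sqrt (Real.log Γ)) := hsum
    _ ≤ N * (Cpart * (Real.sqrt Γ + |τ|) / Real.sqrt (Real.log Γ)) := mul_le_mul_of_nonneg_right hcard hRHS0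
    _ = N * Cpart * (Real.sqrt Γ + |τ|) / Real.sqrt (Real.log Γ) := by ring

/-! ## §3 The registered stub from B1′ alone -/

/-- **`LiaDefectDerivBL` FROM THE SELF-STRAND DERIVATIVE BOUND B1′ ALONE** (B2′ discharged by `liaDefectDeriv_partner_bound`). [folklore] -/
theorem liaDefectDerivBL_of_self_deriv_bound
    (hself : ∀ (N : ℕ) (δd ρd Λd Rwd θd mw : ℝ) (p t : Fin N → EuclideanSpace ℝ (Fin 3)) (γ : Fin N → ℝ) (α : ℝ) (s₀ : Fin N → ℝ),
      0 < N → 0 < δd → 0 < ρd → 0 < Rwd → 0 < θd → 0 < mw → StraightDatum N δd ρd Λd Rwd θd mw p t γ α s₀ →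
      (∀ j k, j ≠ k → |⟪t j, t k⟫_ℝ| ≤ 1 - θd) →
      ∃ Rb₁ : ℝ, 0 < Rb₁ ∧ ∀ Rb : ℝ, 0 < Rb → Rb ≤ Rb₁ → ∃ (Γ₁ Cs : ℝ), ∀ Γ : ℝ, Γ₁ ≤ Γ →
        ∀ (x : Fin N → ℝ → EuclideanSpace ℝ (Fin 3)) (M : EuclideanSpace ℝ (Fin 3) → EuclideanSpace ℝ (Fin 3)),
          IsLiaReference Γ Rb p t γ α s₀ x → SlicedFrame Γ ρd 1 Rb p t s₀ x M →
          ∀ j τ, (Rb * Real.sqrt (Γ * Real.log Γ)) ^ 2 ≤ ‖x j τ‖ ^ 2 → ‖x j τ‖ ^ 2 < 2 * (Rb * Real.sqrt (Γ * Real.log Γ)) ^ 2 →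
            Rb * Real.sqrt (Γ * Real.log Γ) *
              ‖((Γ * γ j / (4 * Real.pi)) • (∫ σ : ℝ, ((-3 * ⟪x j τ - x j σ, deriv (x j) τ⟫_ℝ *
                    ((‖x j τ - x j σ‖ ^ 2 + Real.exp (-(1 + Real.eulerMascheroniConstant - Real.log 2)) * (1:ℝ)) ^ (5 / 2 : ℝ))⁻¹) •
                  cross (deriv (x j) σ) (x j τ - x j σ) +
                ((‖x j τ - x j σ‖ ^ 2 + Real.exp (-(1 + Real.eulerMascheroniConstant - Real.log 2)) * (1:ℝ)) ^ (3 / 2 : ℝ))⁻¹ •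
                  cross (deriv (x j) σ) (deriv (x j) τ))) -
                liaCoeff Γ γ j • (cross (deriv (x j) τ) ((liaCoeff Γ γ j)⁻¹ • (cross (deriv (deriv (x j)) τ) (ambientField Γ p t γ α s₀ j (x j τ)) +
                    cross (deriv (x j) τ) (fderiv ℝ (ambientField Γ p t γ α s₀ j) (x j τ) (deriv (x j) τ)))) +
                  cross (deriv (deriv (x j)) τ) (deriv (deriv (x j)) τ))) -
              ⟪(Γ * γ j / (4 * Real.pi)) • (∫ σ : ℝ, ((-3 * ⟪x j τ - x j σ, deriv (x j) τ⟫_ℝ *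
                    ((‖x j τ - x j σ‖ ^ 2 + Real.exp (-(1 + Real.eulerMascheroniConstant - Real.log 2)) * (1:ℝ)) ^ (5 / 2 : ℝ))⁻¹) •
                  cross (deriv (x j) σ) (x j τ - x j σ) +
                ((‖x j τ - x j σ‖ ^ 2 + Real.exp (-(1 + Real.eulerMascheroniConstant - Real.log 2)) * (1:ℝ)) ^ (3 / 2 : ℝ))⁻¹ •
                  cross (deriv (x j) σ) (deriv (x j) τ))) -
                liaCoeff Γ γ j • (cross (deriv (x j) τ) ((liaCoeff Γ γ j)⁻¹ • (cross (deriv (deriv (x j)) τ) (ambientField Γ p t γ α s₀ j (x j τ)) +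
                    cross (deriv (x j) τ) (fderiv ℝ (ambientField Γ p t γ α s₀ j) (x j τ) (deriv (x j) τ)))) +
                  cross (deriv (deriv (x j)) τ) (deriv (deriv (x j)) τ)), deriv (x j) τ⟫_ℝ • deriv (x j) τ‖ ≤
              Cs * (Real.sqrt Γ + |τ|) / Real.sqrt (Real.log Γ)) :
    LiaDefectDerivBL :=
  liaDefectDerivBL_of_self_and_partner_deriv_bounds hself liaDefectDeriv_partner_bound

end Summit.NavierStokesRegularity.NavierStokesRegularity.Theorems.SkeletonJ1RFrame

end
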